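import Literature.Barriers.Parity.SiegelZeroDichotomyChowla
import Mathlib.Analysis.Fourier.Inversion
import Mathlib.Analysis.Fourier.FourierTransformDeriv
import Mathlib.Analysis.SpecialFunctions.ImproperIntegrals
import Mathlib.Analysis.SpecialFunctions.JapaneseBracket
import HarnessLib

/-!
# Step (iii) of Tao–Teräväinen at `k = 0`, analytic input: the Fourier representation of the
# cutoff `ψ_{>D}` with decay to all orders ((3.17), (6.9), (6.10))

Topic `Literature/Barriers/Parity`, sub-namespace `TaoTeravainen`; a file of the proof DAG of
`Literature.Barriers.Parity.TaoTeravainen2021_chowla`, towards `TaoTeravainen2021_prop63_k0`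
(Proposition 6.3 at `k = 0`). Everything here is PROVED, for an arbitrary smooth cutoff `ψ`
(`IsSmoothCutoff ψ`: smooth, `= 1` on `[-1/2, 1/2]`, `= 0` off `(-1, 1)`, §2.5).

The source (proof of Lemma 6.1): "Applying Fourier inversion (3.16) to the function
`g(u) := e^{-u} (1 - ψ((log_D R) u))` and setting `u := log_R n`, we conclude the identity
(6.9) `ψ_{>D}(n) = ∫_ℝ n^{(1+it)/log R} f(t) dt` where `f(t) := (1/2π) ∫_0^∞ e^{-(1+it)x} (1 - ψ((log_D R) x)) dx`.
From the triangle inequality we have `f(t) ≪ exp(-¼ log_R D) ≪_A log^{-A} η` for any `A > 0`, while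
from repeated integration by parts we have `f(t) ≪_A |t|^{-A}` for any positive integer `A`.
Combining the two bounds, we conclude that (6.10) `f(t) ≪_A exp(-⅛ log_R D) (1+|t|)^{-A}`."
[cite: TaoTeravainen2021, §3.2 (3.16)–(3.17) and §6 (6.9)–(6.10)]

Here, with `κ := log_D R ∈ (0, 1]` and Mathlib's Fourier transform `𝓕` (kernel `e^{-2πi v w}`):
`cutoffTail ψ` is the smooth `Φ` equal to `1 - ψ` on `[-1/2, ∞)` and to `0` on `(-∞, 1/2]` (so
`Φ(κ u) = ψ_{>D}(n)` at `u = log_R n ≥ 0`, (2.13)); `cutoffKernel ψ κ u := e^{-u} Φ(κ u)` is the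
source's `g` (smooth, `= 0` for `u < 1/(2κ)`, `|g^{(m)}| ≤ K_m e^{-u}` uniformly in `κ ≤ 1`, hence
`∫ |g^{(m)}| ≤ K_m exp(-1/(2κ)) = K_m exp(-½ log_R D)`); `cutoffFourier ψ κ := 𝓕 g` is the source's
`f` up to `t ↦ -2πt`, with **decay to all orders carrying the gain**
`(1 + |t|)^A ‖f(t)‖ ≤ C_A exp(-1/(2κ))` (`cutoffFourier_decay`, integration by parts = Mathlib's
`Real.fourier_iteratedDeriv`; integrated form `integral_cutoffFourier_le`), and **the representation**
`1 - ψ(κ u) = e^{u} ∫ e^{2πi t u} f(t) dt` for `u ≥ 0` (`IsSmoothCutoff.one_sub_eq_exp_mul_integral`,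
Fourier inversion = Mathlib's `Continuous.fourierInv_fourier_eq`), which at `u = log n / log R` is
(6.9). We keep the exponent `½` where the source (splitting the gain between two estimates) prints
`⅛`; constants depend on `ψ`, `A` only. NOT here: anything arithmetic (see the `Step3` sequels).
-/

noncomputable section

open Real MeasureTheory Set Filter
open scoped FourierTransform Topology ContDiff

namespace Literature.Barriers.Parity.TaoTeravainen

variable {ψ : ℝ → ℝ}

/-- The tail cutoff `Φ`: `Φ(v) = 0` for `v ≤ 1/2` and `Φ(v) = 1 - ψ(v)` for `v > 1/2`; for a
smooth cutoff `ψ` this is `1 - ψ` on `[-1/2, ∞)`, i.e. `ψ_{>z}(n) = Φ(log_z n)` for `n ≥ 1` ((2.13)).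
[cite: TaoTeravainen2021, §2.5 (2.13)] -/
def cutoffTail (ψ : ℝ → ℝ) (v : ℝ) : ℝ :=
  if v ≤ 1 / 2 then 0 else 1 - ψ v

/-- `Φ = 0` on `(-∞, 1/2]`. [folklore] -/
theorem cutoffTail_of_le_half {v : ℝ} (hv : v ≤ 1 / 2) : cutoffTail ψ v = 0 := if_pos hv

/-- `Φ = 1 - ψ` on `[-1/2, ∞)`. [cite: TaoTeravainen2021, §2.5] -/
theorem IsSmoothCutoff.cutoffTail_eq (hψ : IsSmoothCutoff ψ) {v : ℝ} (hv : -(1 / 2) ≤ v) :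
    cutoffTail ψ v = 1 - ψ v := by
  unfold cutoffTail
  split_ifs with h
  · rw [hψ.eq_one v (abs_le.mpr ⟨hv, h⟩), sub_self]
  · rfl

/-- `Φ = 1` on `[1, ∞)`. [cite: TaoTeravainen2021, §2.5] -/
theorem IsSmoothCutoff.cutoffTail_of_one_le (hψ : IsSmoothCutoff ψ) {v : ℝ} (hv : 1 ≤ v) :
    cutoffTail ψ v = 1 := by
  rw [hψ.cutoffTail_eq (by linarith), hψ.eq_zero v (by rwa [abs_of_pos (by linarith)]), sub_zero]

/-- Near a point `v < 1/2`, `Φ` vanishes identically. [folklore] -/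
theorem cutoffTail_eventuallyEq_zero {v : ℝ} (hv : v < 1 / 2) :
    cutoffTail ψ =ᶠ[𝓝 v] fun _ => (0 : ℝ) :=
  (eventually_lt_nhds hv).mono fun _ hu => cutoffTail_of_le_half hu.le

/-- Near a point `v > -1/2`, `Φ` agrees with `1 - ψ`. [folklore] -/
theorem IsSmoothCutoff.cutoffTail_eventuallyEq_one_sub (hψ : IsSmoothCutoff ψ) {v : ℝ}
    (hv : -(1 / 2) < v) : cutoffTail ψ =ᶠ[𝓝 v] fun u => 1 - ψ u :=
  (eventually_gt_nhds hv).mono fun _ hu => hψ.cutoffTail_eq hu.le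

/-- Near a point `v > 1`, `Φ` is identically `1`. [folklore] -/
theorem IsSmoothCutoff.cutoffTail_eventuallyEq_one (hψ : IsSmoothCutoff ψ) {v : ℝ} (hv : 1 < v) :
    cutoffTail ψ =ᶠ[𝓝 v] fun _ => (1 : ℝ) :=
  (eventually_gt_nhds hv).mono fun _ hu => hψ.cutoffTail_of_one_le hu.le

/-- `Φ` is smooth. [folklore] -/
theorem IsSmoothCutoff.contDiff_cutoffTail (hψ : IsSmoothCutoff ψ) : ContDiff ℝ ∞ (cutoffTail ψ) := by
  refine contDiff_iff_contDiffAt.mpr fun v => ?_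
  rcases lt_or_ge v (1 / 2) with hv | hv
  · exact contDiffAt_const.congr_of_eventuallyEq (cutoffTail_eventuallyEq_zero hv)
  · exact (contDiff_const.sub hψ.contDiff).contDiffAt.congr_of_eventuallyEq
      (hψ.cutoffTail_eventuallyEq_one_sub (by linarith))

/-- All derivatives of `Φ` vanish on `(-∞, 1/2)`. [folklore] -/
theorem iteratedDeriv_cutoffTail_of_lt_half (n : ℕ) {v : ℝ} (hv : v < 1 / 2) :
    iteratedDeriv n (cutoffTail ψ) v = 0 := by
  rw [(cutoffTail_eventuallyEq_zero hv).iteratedDeriv_eq n, iteratedDeriv_const]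
  simp

/-- The derivatives of order `≥ 1` of `Φ` vanish on `(1, ∞)`. [folklore] -/
theorem IsSmoothCutoff.iteratedDeriv_cutoffTail_of_one_lt (hψ : IsSmoothCutoff ψ) {n : ℕ} (hn : n ≠ 0)
    {v : ℝ} (hv : 1 < v) : iteratedDeriv n (cutoffTail ψ) v = 0 := by
  rw [(hψ.cutoffTail_eventuallyEq_one hv).iteratedDeriv_eq n, iteratedDeriv_const, if_neg hn]

/-- Each derivative of `Φ` is bounded on `ℝ` (continuous, locally constant off `[0, 2]`). [folklore] -/
theorem IsSmoothCutoff.exists_bound_iteratedDeriv_cutoffTail (hψ : IsSmoothCutoff ψ) (n : ℕ) :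
    ∃ M : ℝ, ∀ v : ℝ, |iteratedDeriv n (cutoffTail ψ) v| ≤ M := by
  have hcont : Continuous (iteratedDeriv n (cutoffTail ψ)) :=
    hψ.contDiff_cutoffTail.continuous_iteratedDeriv n (by exact_mod_cast le_top)
  obtain ⟨B, hB⟩ := isCompact_Icc.exists_bound_of_continuousOn (hcont.continuousOn (s := Icc 0 2))
  refine ⟨max B 1, fun v => ?_⟩
  rcases lt_or_ge v 0 with hv | hv
  · rw [iteratedDeriv_cutoffTail_of_lt_half n (by linarith), abs_zero]
    exact le_max_of_le_right zero_le_one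
  rcases le_or_gt v 2 with hv2 | hv2
  · exact (hB v ⟨hv, hv2⟩).trans (le_max_left _ _)
  · rcases eq_or_ne n 0 with rfl | hn
    · rw [iteratedDeriv_zero, hψ.cutoffTail_of_one_le (by linarith), abs_one]
      exact le_max_right _ _
    · rw [hψ.iteratedDeriv_cutoffTail_of_one_lt hn (by linarith), abs_zero]
      exact le_max_of_le_right zero_le_one

/-! ### The kernel `g(u) = e^{-u} Φ(κ u)` -/

/-- **The source's `g`**: `cutoffKernel ψ κ u := e^{-u} Φ(κ u)`, `κ = log_D R`; for `u ≥ 0` this is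
`e^{-u} (1 - ψ(κ u))`. [cite: TaoTeravainen2021, §6 (proof of Lemma 6.1, before (6.9))] -/
def cutoffKernel (ψ : ℝ → ℝ) (κ u : ℝ) : ℝ :=
  Real.exp (-u) * cutoffTail ψ (κ * u)

/-- `g` is smooth. [folklore] -/
theorem IsSmoothCutoff.contDiff_cutoffKernel (hψ : IsSmoothCutoff ψ) (κ : ℝ) :
    ContDiff ℝ ∞ (cutoffKernel ψ κ) :=
  (Real.contDiff_exp.comp contDiff_neg).mul
    (hψ.contDiff_cutoffTail.comp (contDiff_const.mul contDiff_id))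

/-- `g` and all its derivatives vanish on `u < 1/(2κ)` (`κ > 0`). [folklore] -/
theorem iteratedDeriv_cutoffKernel_of_lt {κ : ℝ} (hκ : 0 < κ) (n : ℕ) {u : ℝ} (hu : u < 1 / (2 * κ)) :
    iteratedDeriv n (cutoffKernel ψ κ) u = 0 := by
  have hev : cutoffKernel ψ κ =ᶠ[𝓝 u] fun _ => (0 : ℝ) := by
    refine (eventually_lt_nhds hu).mono fun w hw => ?_
    have : κ * w < 1 / 2 := by
      rw [lt_div_iff₀ (by positivity)] at hw
      linarith
    simp [cutoffKernel, cutoffTail_of_le_half this.le]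
  rw [hev.iteratedDeriv_eq n, iteratedDeriv_const]
  simp

/-- The `n`-th derivative of `u ↦ e^{-u}` is `(-1)ⁿ e^{-u}`. [folklore] -/
theorem iteratedDeriv_exp_neg (n : ℕ) (u : ℝ) :
    iteratedDeriv n (fun w => Real.exp (-w)) u = (-1) ^ n * Real.exp (-u) := by
  rw [iteratedDeriv_comp_neg n Real.exp u, iteratedDeriv_eq_iterate, Real.iter_deriv_exp, smul_eq_mul]

/-- **Uniform derivative bounds for `g`**: for each `n` there is `K` (depending on `ψ`, `n` only)
with `|g^{(n)}(u)| ≤ K e^{-u}` for all `u` and all `0 < κ ≤ 1` (Leibniz rule; the derivatives of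
`Φ(κ ·)` are `κʲ Φ^{(j)}(κ ·)`, bounded by `sup |Φ^{(j)}|`). This is the content of "repeated
integration by parts" in the source. [cite: TaoTeravainen2021, §6 (proof of (6.10))] -/
theorem IsSmoothCutoff.exists_bound_iteratedDeriv_cutoffKernel (hψ : IsSmoothCutoff ψ) (n : ℕ) :
    ∃ K : ℝ, 0 ≤ K ∧ ∀ κ : ℝ, 0 < κ → κ ≤ 1 → ∀ u : ℝ,
      |iteratedDeriv n (cutoffKernel ψ κ) u| ≤ K * Real.exp (-u) := by
  choose M hM using hψ.exists_bound_iteratedDeriv_cutoffTail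
  have hM0 : ∀ j, 0 ≤ M j := fun j => (abs_nonneg _).trans (hM j 0)
  refine ⟨∑ i ∈ Finset.range (n + 1), (n.choose i : ℝ) * M (n - i),
    Finset.sum_nonneg fun i _ => mul_nonneg (Nat.cast_nonneg _) (hM0 _), fun κ hκ hκ1 u => ?_⟩
  have hf : ContDiff ℝ ∞ fun w : ℝ => Real.exp (-w) := Real.contDiff_exp.comp contDiff_neg
  have hg : ContDiff ℝ ∞ fun w : ℝ => cutoffTail ψ (κ * w) :=
    hψ.contDiff_cutoffTail.comp (contDiff_const.mul contDiff_id)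
  have hL := norm_iteratedFDeriv_mul_le hf hg u (n := n) (by exact_mod_cast le_top)
  rw [norm_iteratedFDeriv_eq_norm_iteratedDeriv] at hL
  change ‖iteratedDeriv n (cutoffKernel ψ κ) u‖ ≤ _ at hL
  rw [Real.norm_eq_abs] at hL
  refine hL.trans ?_
  rw [Finset.sum_mul]
  refine Finset.sum_le_sum fun i hi => ?_
  rw [norm_iteratedFDeriv_eq_norm_iteratedDeriv, norm_iteratedFDeriv_eq_norm_iteratedDeriv,
    iteratedDeriv_exp_neg, iteratedDeriv_comp_const_mul
      (hψ.contDiff_cutoffTail.of_le (WithTop.coe_le_coe.mpr le_top)) κ]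
  rw [Real.norm_eq_abs, Real.norm_eq_abs, abs_mul, abs_pow, abs_neg, abs_one, one_pow, one_mul,
    abs_of_pos (Real.exp_pos _), abs_mul, abs_pow, abs_of_pos hκ]
  have h1 : κ ^ (n - i) * |iteratedDeriv (n - i) (cutoffTail ψ) (κ * u)| ≤ M (n - i) :=
    (mul_le_of_le_one_left (abs_nonneg _) (pow_le_one₀ hκ.le hκ1)).trans (hM _ _)
  calc (n.choose i : ℝ) * Real.exp (-u) * (κ ^ (n - i) * |iteratedDeriv (n - i) (cutoffTail ψ) (κ * u)|)
      ≤ (n.choose i : ℝ) * Real.exp (-u) * M (n - i) := by gcongr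
    _ = (n.choose i : ℝ) * M (n - i) * Real.exp (-u) := by ring

/-- **`∫ |g^{(n)}| ≤ K exp(-1/(2κ))`** and `g^{(n)}` is integrable: the derivative vanishes below
`1/(2κ)` and is `≤ K e^{-u}` above (the gain `exp(-½ log_R D)`; the source's "From the triangle
inequality we have `f(t) ≪ exp(-¼ log_R D)`"). [cite: TaoTeravainen2021, §6 (proof of (6.10))] -/
theorem IsSmoothCutoff.integrable_iteratedDeriv_cutoffKernel (hψ : IsSmoothCutoff ψ) (n : ℕ) :
    ∃ K : ℝ, 0 ≤ K ∧ ∀ κ : ℝ, 0 < κ → κ ≤ 1 →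
      Integrable (iteratedDeriv n (cutoffKernel ψ κ)) ∧
        ∫ u, |iteratedDeriv n (cutoffKernel ψ κ) u| ≤ K * Real.exp (-(1 / (2 * κ))) := by
  obtain ⟨K, hK0, hK⟩ := hψ.exists_bound_iteratedDeriv_cutoffKernel n
  refine ⟨K, hK0, fun κ hκ hκ1 => ?_⟩
  set a : ℝ := 1 / (2 * κ) with ha
  set G := iteratedDeriv n (cutoffKernel ψ κ) with hG
  have hcont : Continuous G :=
    (hψ.contDiff_cutoffKernel κ).continuous_iteratedDeriv n (by exact_mod_cast le_top)
  -- `G` vanishes off `[a, ∞)`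
  have hind : G = (Ici a).indicator G := by
    ext u
    by_cases hu : u ∈ Ici a
    · rw [indicator_of_mem hu]
    · rw [indicator_of_notMem hu, hG, iteratedDeriv_cutoffKernel_of_lt hκ n (not_le.mp hu)]
  have hexp : IntegrableOn (fun u => K * Real.exp (-u)) (Ici a) := by
    rw [integrableOn_Ici_iff_integrableOn_Ioi]
    have h := (exp_neg_integrableOn_Ioi a one_pos).const_mul K
    simp only [neg_mul, one_mul] at h
    exact h
  have hGon : IntegrableOn G (Ici a) :=
    Integrable.mono' hexp hcont.aestronglyMeasurable.restrict
      (ae_of_all _ fun u => by rw [Real.norm_eq_abs]; exact hK κ hκ hκ1 u)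
  have hGint : Integrable G := by
    rw [hind]
    exact hGon.integrable_indicator measurableSet_Ici
  refine ⟨hGint, ?_⟩
  calc ∫ u, |G u| = ∫ u, (Ici a).indicator (fun u => |G u|) u := by
        congr 1
        ext u
        by_cases hu : u ∈ Ici a
        · rw [indicator_of_mem hu]
        · rw [indicator_of_notMem hu, hG, iteratedDeriv_cutoffKernel_of_lt hκ n (not_le.mp hu),
            abs_zero]
    _ = ∫ u in Ici a, |G u| := integral_indicator measurableSet_Ici
    _ ≤ ∫ u in Ici a, K * Real.exp (-u) :=
        setIntegral_mono_on hGon.abs hexp measurableSet_Ici fun u _ => hK κ hκ hκ1 u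
    _ = K * Real.exp (-a) := by
        rw [integral_Ici_eq_integral_Ioi, integral_const_mul, integral_exp_neg_Ioi]

/-! ### The Fourier transform `f = 𝓕 g` and its decay -/

/-- **The source's `f`** (up to `t ↦ -2πt`): the Fourier transform of `g`,
`cutoffFourier ψ κ t = ∫ e^{-2πi u t} g(u) du`. [cite: TaoTeravainen2021, §6 (6.9)] -/
def cutoffFourier (ψ : ℝ → ℝ) (κ : ℝ) : ℝ → ℂ :=
  𝓕 (fun u : ℝ => (cutoffKernel ψ κ u : ℂ))

/-- Complexification commutes with iterated derivatives (smooth real functions). [folklore] -/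
theorem iteratedDeriv_ofReal_comp {g : ℝ → ℝ} (hg : ContDiff ℝ ∞ g) (n : ℕ) :
    iteratedDeriv n (fun x => (g x : ℂ)) = fun x => ((iteratedDeriv n g x : ℝ) : ℂ) := by
  induction n with
  | zero => simp [iteratedDeriv_zero]
  | succ n ih =>
    rw [iteratedDeriv_succ, ih, iteratedDeriv_succ]
    ext x
    have hd : Differentiable ℝ (iteratedDeriv n g) :=
      hg.differentiable_iteratedDeriv n (by exact_mod_cast ENat.coe_lt_top n)
    exact ((hd x).hasDerivAt.ofReal_comp).deriv

/-- **Decay of `f` to all orders, with the gain**: for each `A` there is `C` (depending on `ψ`, `A`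
only) such that `(1 + |t|)^A ‖f(t)‖ ≤ C exp(-1/(2κ))` for all `t` and all `0 < κ ≤ 1`
(`(2π|t|)ⁿ ‖𝓕 g(t)‖ = ‖𝓕 g⁽ⁿ⁾(t)‖ ≤ ∫ |g⁽ⁿ⁾|` with `n = 0` and `n = A`).
[cite: TaoTeravainen2021, §6 (6.10)] -/
theorem IsSmoothCutoff.cutoffFourier_decay (hψ : IsSmoothCutoff ψ) (A : ℕ) :
    ∃ C : ℝ, 0 ≤ C ∧ ∀ κ : ℝ, 0 < κ → κ ≤ 1 → ∀ t : ℝ,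
      (1 + |t|) ^ A * ‖cutoffFourier ψ κ t‖ ≤ C * Real.exp (-(1 / (2 * κ))) := by
  choose K hK0 hK using hψ.integrable_iteratedDeriv_cutoffKernel
  refine ⟨2 ^ A * (K 0 + K A / (2 * π) ^ A),
    by have := hK0 0; have := hK0 A; positivity, fun κ hκ hκ1 t => ?_⟩
  set gc : ℝ → ℂ := fun u => (cutoffKernel ψ κ u : ℂ) with hgc
  have hgc_smooth : ContDiff ℝ ∞ gc := Complex.ofRealCLM.contDiff.comp (hψ.contDiff_cutoffKernel κ)
  have hder : ∀ n : ℕ, iteratedDeriv n gc = fun u => ((iteratedDeriv n (cutoffKernel ψ κ) u : ℝ) : ℂ) :=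
    fun n => iteratedDeriv_ofReal_comp (hψ.contDiff_cutoffKernel κ) n
  have hint : ∀ n : ℕ, Integrable (iteratedDeriv n gc) := fun n => by
    rw [hder n]
    exact (hK n κ hκ hκ1).1.ofReal
  -- `(2π|t|)ⁿ ‖𝓕 g t‖ ≤ ∫ |g⁽ⁿ⁾| ≤ K n · exp(-1/(2κ))`
  have hbound : ∀ n : ℕ, (2 * π * |t|) ^ n * ‖cutoffFourier ψ κ t‖ ≤ K n * Real.exp (-(1 / (2 * κ))) := by
    intro n
    have hF := Real.fourier_iteratedDeriv (N := (⊤ : ℕ∞)) hgc_smooth (fun m _ => hint m)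
      (n := n) le_top
    have h1 : ‖𝓕 (iteratedDeriv n gc) t‖ ≤ ∫ u, ‖iteratedDeriv n gc u‖ :=
      VectorFourier.norm_fourierIntegral_le_integral_norm _ _ _ _ _
    rw [hF] at h1
    rw [norm_smul, norm_pow] at h1
    have h2 : ‖(2 * π * Complex.I * t : ℂ)‖ = 2 * π * |t| := by
      simp [abs_of_pos Real.pi_pos]
    rw [h2] at h1
    refine h1.trans ?_
    rw [hder n]
    simp only [Complex.norm_real, Real.norm_eq_abs]
    exact (hK n κ hκ hκ1).2
  have h0 := hbound 0; have hA := hbound A; rw [pow_zero, one_mul] at h0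
  have hpi : 0 < (2 * π) ^ A := by positivity
  have hA' : |t| ^ A * ‖cutoffFourier ψ κ t‖ ≤ K A / (2 * π) ^ A * Real.exp (-(1 / (2 * κ))) := by
    rw [mul_pow] at hA
    rw [div_mul_eq_mul_div, le_div_iff₀ hpi]
    linarith
  -- `(1 + |t|)^A ≤ 2^A (1 + |t|^A)`
  have hconv : (1 + |t|) ^ A ≤ 2 ^ A * (1 + |t| ^ A) := by
    have h1 : 1 + |t| ≤ 2 * max 1 |t| := by
      rcases le_or_gt 1 |t| with h | h
      · rw [max_eq_right h]; linarith
      · rw [max_eq_left h.le]; linarith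
    calc (1 + |t|) ^ A ≤ (2 * max 1 |t|) ^ A := pow_le_pow_left₀ (by positivity) h1 A
      _ = 2 ^ A * max 1 |t| ^ A := mul_pow _ _ _
      _ ≤ 2 ^ A * (1 + |t| ^ A) := by
          gcongr
          rcases le_or_gt 1 |t| with h | h
          · rw [max_eq_right h]; linarith
          · rw [max_eq_left h.le, one_pow]; linarith [pow_nonneg (abs_nonneg t) A]
  calc (1 + |t|) ^ A * ‖cutoffFourier ψ κ t‖ ≤ 2 ^ A * (1 + |t| ^ A) * ‖cutoffFourier ψ κ t‖ := by
        gcongr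
    _ = 2 ^ A * (‖cutoffFourier ψ κ t‖ + |t| ^ A * ‖cutoffFourier ψ κ t‖) := by ring
    _ ≤ 2 ^ A * (K 0 * Real.exp (-(1 / (2 * κ))) + K A / (2 * π) ^ A * Real.exp (-(1 / (2 * κ)))) := by
        gcongr
    _ = 2 ^ A * (K 0 + K A / (2 * π) ^ A) * Real.exp (-(1 / (2 * κ))) := by ring

/-- `f` is continuous. [folklore] -/
theorem IsSmoothCutoff.continuous_cutoffFourier (hψ : IsSmoothCutoff ψ) {κ : ℝ} (hκ : 0 < κ)
    (hκ1 : κ ≤ 1) : Continuous (cutoffFourier ψ κ) := by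
  obtain ⟨K, -, hK⟩ := hψ.integrable_iteratedDeriv_cutoffKernel 0
  have hint : Integrable fun u : ℝ => (cutoffKernel ψ κ u : ℂ) := by
    have := (hK κ hκ hκ1).1
    rw [iteratedDeriv_zero] at this
    exact this.ofReal
  exact VectorFourier.fourierIntegral_continuous Real.continuous_fourierChar
    (by exact continuous_inner) hint

/-- `(1 + |t|)^A ‖f(t)‖` is integrable (from the decay at order `A + 2`). [folklore] -/
theorem IsSmoothCutoff.integrable_pow_mul_norm_cutoffFourier (hψ : IsSmoothCutoff ψ) (A : ℕ) {κ : ℝ}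
    (hκ : 0 < κ) (hκ1 : κ ≤ 1) :
    Integrable fun t : ℝ => (1 + |t|) ^ A * ‖cutoffFourier ψ κ t‖ := by
  obtain ⟨C, hC0, hC⟩ := hψ.cutoffFourier_decay (A + 2)
  have hdom : Integrable fun t : ℝ => C * Real.exp (-(1 / (2 * κ))) * (1 + ‖t‖) ^ (-(2 : ℝ)) :=
    (integrable_one_add_norm (by rw [Module.finrank_self]; norm_num)).const_mul _
  refine hdom.mono' ?_ (ae_of_all _ fun t => ?_)
  · exact (Continuous.mul (by fun_prop) (hψ.continuous_cutoffFourier hκ hκ1).norm).aestronglyMeasurable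
  · rw [Real.norm_eq_abs, abs_of_nonneg (by positivity), Real.norm_eq_abs]
    have h1 : 0 < (1 + |t|) ^ 2 := by positivity
    rw [Real.rpow_neg (by positivity), ← div_eq_mul_inv, le_div_iff₀ (by positivity),
      show ((1 : ℝ) + |t|) ^ (2 : ℝ) = (1 + |t|) ^ 2 by norm_cast]
    calc (1 + |t|) ^ A * ‖cutoffFourier ψ κ t‖ * (1 + |t|) ^ 2
        = (1 + |t|) ^ (A + 2) * ‖cutoffFourier ψ κ t‖ := by ring
      _ ≤ C * Real.exp (-(1 / (2 * κ))) := hC κ hκ hκ1 t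

/-- **The integrated decay bound**: `∫ (1 + |t|)^A ‖f(t)‖ dt ≤ C exp(-1/(2κ))`, `C = C(ψ, A)`,
uniformly in `0 < κ ≤ 1` (this is how (6.10) is consumed in the proof of (6.5)).
[cite: TaoTeravainen2021, §6 (6.10) and the last display of the proof of Lemma 6.1] -/
theorem IsSmoothCutoff.integral_cutoffFourier_le (hψ : IsSmoothCutoff ψ) (A : ℕ) :
    ∃ C : ℝ, 0 ≤ C ∧ ∀ κ : ℝ, 0 < κ → κ ≤ 1 →
      ∫ t, (1 + |t|) ^ A * ‖cutoffFourier ψ κ t‖ ≤ C * Real.exp (-(1 / (2 * κ))) := by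
  obtain ⟨C, hC0, hC⟩ := hψ.cutoffFourier_decay (A + 2)
  set Z : ℝ := ∫ t : ℝ, (1 + ‖t‖) ^ (-(2 : ℝ)) with hZ
  have hZ0 : 0 ≤ Z := integral_nonneg fun t => by positivity
  refine ⟨C * Z, by positivity, fun κ hκ hκ1 => ?_⟩
  have hdom : Integrable fun t : ℝ => C * Real.exp (-(1 / (2 * κ))) * (1 + ‖t‖) ^ (-(2 : ℝ)) :=
    (integrable_one_add_norm (by rw [Module.finrank_self]; norm_num)).const_mul _
  calc ∫ t, (1 + |t|) ^ A * ‖cutoffFourier ψ κ t‖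
      ≤ ∫ t : ℝ, C * Real.exp (-(1 / (2 * κ))) * (1 + ‖t‖) ^ (-(2 : ℝ)) := by
        refine integral_mono (hψ.integrable_pow_mul_norm_cutoffFourier A hκ hκ1) hdom fun t => ?_
        dsimp only
        rw [Real.norm_eq_abs, Real.rpow_neg (by positivity), ← div_eq_mul_inv,
          le_div_iff₀ (by positivity), show ((1 : ℝ) + |t|) ^ (2 : ℝ) = (1 + |t|) ^ 2 by norm_cast]
        calc (1 + |t|) ^ A * ‖cutoffFourier ψ κ t‖ * (1 + |t|) ^ 2
            = (1 + |t|) ^ (A + 2) * ‖cutoffFourier ψ κ t‖ := by ring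
          _ ≤ C * Real.exp (-(1 / (2 * κ))) := hC κ hκ hκ1 t
    _ = C * Z * Real.exp (-(1 / (2 * κ))) := by
        rw [integral_const_mul, hZ]; ring

/-! ### Fourier inversion: the representation (6.9) -/

/-- **The Fourier representation of the cutoff** ((3.16)–(3.17), (6.9)): for `u ≥ 0` and
`0 < κ ≤ 1`, `1 - ψ(κ u) = e^{u} ∫ e^{2πi t u} f(t) dt` (Fourier inversion for the smooth integrable
`g` with integrable transform). At `u = log n / log R`, `κ = log_D R` this reads
`ψ_{>D}(n) = ∫ n^{(1 + 2πi t)/log R} f(t) dt`. [cite: TaoTeravainen2021, §3.2 (3.16)–(3.17) and §6 (6.9)] -/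
theorem IsSmoothCutoff.one_sub_eq_exp_mul_integral (hψ : IsSmoothCutoff ψ) {κ : ℝ} (hκ : 0 < κ)
    (hκ1 : κ ≤ 1) {u : ℝ} (hu : 0 ≤ u) :
    ((1 - ψ (κ * u) : ℝ) : ℂ) =
      Real.exp u * ∫ t : ℝ, Complex.exp (↑(2 * π * (t * u)) * Complex.I) * cutoffFourier ψ κ t := by
  set gc : ℝ → ℂ := fun w => (cutoffKernel ψ κ w : ℂ) with hgc
  have hcont : Continuous gc :=
    Complex.continuous_ofReal.comp (hψ.contDiff_cutoffKernel κ).continuous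
  obtain ⟨K, -, hK⟩ := hψ.integrable_iteratedDeriv_cutoffKernel 0
  have hint : Integrable gc := by
    have := (hK κ hκ hκ1).1
    rw [iteratedDeriv_zero] at this
    exact this.ofReal
  have hFint : Integrable (𝓕 gc) := by
    have h := hψ.integrable_pow_mul_norm_cutoffFourier 0 hκ hκ1
    simp only [pow_zero, one_mul] at h
    exact (integrable_norm_iff (hψ.continuous_cutoffFourier hκ hκ1).aestronglyMeasurable).mp h
  have hinv := congr_fun (hcont.fourierInv_fourier_eq hint hFint) u
  rw [Real.fourierInv_eq'] at hinv
  -- `g(u) = e^{-u} (1 - ψ(κ u))`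
  have hgu : gc u = ((Real.exp (-u) * (1 - ψ (κ * u)) : ℝ) : ℂ) := by
    rw [hgc]
    dsimp only
    rw [cutoffKernel, hψ.cutoffTail_eq]
    nlinarith [mul_nonneg hκ.le hu]
  rw [hgu] at hinv
  have hexp : (Real.exp u : ℂ) * (Real.exp (-u) : ℂ) = 1 := by
    rw [← Complex.ofReal_mul, ← Real.exp_add, add_neg_cancel, Real.exp_zero, Complex.ofReal_one]
  calc ((1 - ψ (κ * u) : ℝ) : ℂ) = Real.exp u * ((Real.exp (-u) * (1 - ψ (κ * u)) : ℝ) : ℂ) := by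
        rw [Complex.ofReal_mul (Real.exp (-u)), ← mul_assoc, hexp, one_mul]
    _ = Real.exp u * ∫ t : ℝ, Complex.exp (↑(2 * π * (t * u)) * Complex.I) * cutoffFourier ψ κ t := by
        rw [← hinv]
        congr 1
        refine integral_congr_ae (ae_of_all _ fun t => ?_)
        simp only [RCLike.inner_apply, conj_trivial, smul_eq_mul, cutoffFourier, hgc]
        ring_nf

end Literature.Barriers.Parity.TaoTeravainen
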